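import Literature.Computability.Complexity.AverageCaseDepthHierarchyParams
import Literature.Computability.Complexity.AverageCaseDepthHierarchyTypical
import Literature.Computability.Complexity.AverageCaseDepthHierarchyNumeric
import HarnessLib

/-!
# The stage laws of the RST process satisfy the hypotheses of the switching lemma and of the
# typicality estimates (RST Lemma 13, Proposition 12)

B. Rossman, R. A. Servedio, L.-Y. Tan, *An average-case depth hierarchy theorem for Boolean
circuits*, arXiv:1504.03398 [RossmanServedioTan2015], §10.1 Lemma 13 (pp. 32–33: for an
acceptable block `q_a = q(1 ± O(t_k w^β))`) and Proposition 12 (p. 34: the projection switching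
lemma applies at every stage with `Γ ≍ λ/q³`).

Given the elementary facts about the parameters in RST's regime, bundled as `RegimeFacts m d`
(`q ≤ 1/16`, `0 < λ ≤ p/2`, `t_k ∈ [q/2, 2q]`, `64 q Δ_j ≤ 1`; the sibling asymptotics file derives
them from Lemma 7.1 for `m ≥ m₀`, `d ≤ c m / log m`), this file proves for every stage law
`rstLaw m d k`:
* `lawBounds_mid` / `lawBounds_top` — the two-sided bounds `LawBounds` on the star probability
  `q_a` (window `q (1 ± 16 q Δ_k)` below the top, `q_a = q` exactly at the top), via the defining
  identity `(1 - t_{k+1})^{qw} = λ + q t_k` (`rstT_identity`) and `qa_window`;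
* `pslHyp_mid` / `pslHyp_top` — the side conditions of `psl_level` with `Γ = λ/(16 q³)`.
-/

noncomputable section

namespace Literature.Computability.Complexity

namespace RSTProj

open Finset

/-- The elementary facts about RST's parameters used stage by stage (all consequences of
`m ≥ m₀` and `d ≤ c m / log m`, see the asymptotics file). [cite: RossmanServedioTan2015, §7.1 Lemma 7.1 (p. 16) and §10.1 (p. 32)] -/
structure RegimeFacts (m d : ℕ) : Prop where
  /-- depth at least two -/
  two_le : 2 ≤ d
  /-- `q = 2^{-m/2}` is small -/
  q_le : rstQ m ≤ 1 / 16
  /-- `λ > 0` -/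
  lam_pos : 0 < rstLam m
  /-- `λ ≤ p/2` -/
  lam_le : rstLam m ≤ rstQ m ^ 2 / 2
  /-- Lemma 7.1 in the weak form `t_k ∈ [q/2, 2q]` -/
  t_win : ∀ k, 1 ≤ k → k ≤ d - 1 → rstQ m / 2 ≤ rstT m d k ∧ rstT m d k ≤ 2 * rstQ m
  /-- the acceptability radii are `≪ 1/q` -/
  delta_small : ∀ j, 64 * rstQ m * rstDelta m d j ≤ 1

namespace RegimeFacts

variable {m d : ℕ}

/-- `rstTk = rstT` below the top. [folklore] -/
theorem rstTk_eq {k : ℕ} (hk : k < d) : rstTk m d k = rstT m d k := by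
  unfold rstTk; rw [if_neg (by omega)]

/-- **The defining identity of the `t_k`** (eq. (11)): `(1 - t_{k+1})^{qw} = λ + q t_k` for
`k ≤ d-2`. [cite: RossmanServedioTan2015, §7.1 eq. (11) (p. 16)] -/
theorem rstT_identity {k : ℕ} (hk2 : k + 2 ≤ d) :
    (1 - rstT m d (k + 1)) ^ (rstQ m * rstW m) = rstLam m + rstQ m * rstT m d k := by
  have hq := rstQ_pos m
  unfold rstT
  rw [show d - 1 - k = (d - 1 - (k + 1)) + 1 by omega, rstTAux]
  field_simp
  ring

/-- At the top stage the star probability is `1/2`. [cite: RossmanServedioTan2015, §7.2 Def. 6 (p. 16)] -/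
theorem t_top (hd : 2 ≤ d) : (rstLaw m d (d - 1)).t = 1 / 2 := by
  show rstTk m d (d - 1 + 1) = 1 / 2
  unfold rstTk; rw [if_pos (by omega)]

variable (H : RegimeFacts m d)
include H

/-- `0 < t_k ≤ 1/2 < 1`. [cite: RossmanServedioTan2015, §7.1 Lemma 7.1 (p. 16)] -/
theorem t_mem {k : ℕ} (hk1 : 1 ≤ k) (hkd : k ≤ d - 1) : 0 < rstT m d k ∧ rstT m d k ≤ 1 / 2 ∧ rstT m d k < 1 := by
  have hq := rstQ_pos m
  obtain ⟨h1, h2⟩ := H.t_win k hk1 hkd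
  refine ⟨by linarith, by linarith [H.q_le], by linarith [H.q_le]⟩

/-- **Lemma 13 for the RST laws**: at a stage `k ≤ d-2`, an acceptable block (`|n - qw| ≤ Δ_k`)
has `|q_a - q| ≤ 16 q² Δ_k` and `(1-t)^n ≤ 4 q²`. [cite: RossmanServedioTan2015, §10.1 Lemma 13 (pp. 32–33)] -/
theorem qa_mid {k : ℕ} (hk1 : 1 ≤ k) (hk2 : k + 2 ≤ d) {n : ℕ} (hn : (rstLaw m d k).acc n = true) :
    |(rstLaw m d k).qa n - rstQ m| ≤ 16 * rstQ m ^ 2 * rstDelta m d k ∧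
      0 ≤ (1 - (rstLaw m d k).t) ^ n ∧ (1 - (rstLaw m d k).t) ^ n ≤ 4 * rstQ m ^ 2 := by
  have hq := rstQ_pos m
  -- unpack acceptability
  have hacc : |(n : ℝ) - rstQ m * rstW m| ≤ rstDelta m d k := by
    have : rstAcc m d k n = true := hn
    unfold rstAcc at this
    rw [if_neg (by omega), if_neg (by omega)] at this
    exact of_decide_eq_true this
  -- the parameters of the stage
  have et : (rstLaw m d k).t = rstT m d (k + 1) := rstTk_eq (by omega)
  have et' : (rstLaw m d k).t' = rstT m d k := rstTk_eq (by omega)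
  obtain ⟨ht0, ht2, ht1⟩ := H.t_mem (k := k + 1) (by omega) (by omega)
  obtain ⟨htlo, hthi⟩ := H.t_win (k + 1) (by omega) (by omega)
  obtain ⟨ht'lo, ht'hi⟩ := H.t_win k hk1 (by omega)
  have hΔ0 : 0 ≤ rstDelta m d k := Real.rpow_nonneg (Nat.cast_nonneg _) _
  have htΔ : 2 * rstT m d (k + 1) * rstDelta m d k ≤ 1 / 4 := by
    have := H.delta_small k
    nlinarith [mul_nonneg ht0.le hΔ0]
  -- `(1-t)^n = (λ + q t') (1-t)^δ`
  set δ := (n : ℝ) - rstQ m * rstW m with hδ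
  have hpow : ((1 - rstT m d (k + 1)) ^ n : ℝ) = (rstLam m + rstQ m * rstT m d k) * (1 - rstT m d (k + 1)) ^ δ := by
    rw [← rstT_identity hk2, ← Real.rpow_add (by linarith), show rstQ m * rstW m + δ = (n : ℝ) by rw [hδ]; ring,
      Real.rpow_natCast]
  have key := qa_window hq ht0.le hthi ht2 ht'lo ht'hi (rstLam_nonneg m) H.lam_le hΔ0 htΔ hacc
  rw [← hpow] at key
  refine ⟨?_, by rw [et]; exact key.2.1, by rw [et]; exact key.2.2⟩
  show |((1 - (rstLaw m d k).t) ^ n - (rstLaw m d k).lam) / (rstLaw m d k).t' - rstQ m| ≤ _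
  rw [et, et']
  exact key.1

/-- **`LawBounds` below the top**: `q_a ∈ [q (1 - 16 q Δ_k), q (1 + 16 q Δ_k)]`. [cite: RossmanServedioTan2015, §10.1 Lemma 13 (pp. 32–33)] -/
theorem lawBounds_mid {k : ℕ} (hk1 : 1 ≤ k) (hk2 : k + 2 ≤ d) :
    (rstLaw m d k).LawBounds (rstQ m * (1 - 16 * rstQ m * rstDelta m d k)) (rstQ m * (1 + 16 * rstQ m * rstDelta m d k)) := by
  have hq := rstQ_pos m
  have hΔ0 : 0 ≤ rstDelta m d k := Real.rpow_nonneg (Nat.cast_nonneg _) _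
  have hsmall := H.delta_small k
  obtain ⟨ht0, ht2, ht1⟩ := H.t_mem (k := k + 1) (by omega) (by omega)
  have et : (rstLaw m d k).t = rstT m d (k + 1) := rstTk_eq (by omega)
  refine ⟨by rw [et]; exact ht0, by rw [et]; exact ht1.le, rstLam_nonneg m, ?_, ?_, fun n hn _ => ?_, ?_⟩
  · apply mul_nonneg hq.le; nlinarith
  · apply mul_le_mul_of_nonneg_left _ hq.le; nlinarith [mul_nonneg hq.le hΔ0]
  · have h := (H.qa_mid hk1 hk2 hn).1
    rw [abs_le] at h
    constructor <;> nlinarith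
  · show rstQ m * (1 + 16 * rstQ m * rstDelta m d k) ≤ 1 - rstLam m
    nlinarith [H.lam_le, H.q_le, mul_nonneg hq.le hΔ0]

/-- **The switching-lemma side conditions below the top** with `Γ = λ/(16 q³)`. [cite: RossmanServedioTan2015, §10.1 Prop. 12 (p. 34)] -/
theorem pslHyp_mid {k : ℕ} (hk1 : 1 ≤ k) (hk2 : k + 2 ≤ d) :
    ∀ n, (rstLaw m d k).acc n = true → 1 ≤ n →
      0 < (rstLaw m d k).qa n ∧ (rstLaw m d k).qa n ≤ 1 - (rstLaw m d k).lam ∧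
        rstLam m / (16 * rstQ m ^ 3) * (rstLaw m d k).qa n ≤ 1 - (rstLaw m d k).lam - (rstLaw m d k).qa n ∧
        rstLam m / (16 * rstQ m ^ 3) * (rstLaw m d k).qa n * (1 - (rstLaw m d k).t) ^ n ≤
          (rstLaw m d k).lam * (1 - (1 - (rstLaw m d k).t) ^ n) := by
  intro n hn _
  have hq := rstQ_pos m
  have hΔ0 : 0 ≤ rstDelta m d k := Real.rpow_nonneg (Nat.cast_nonneg _) _
  have hsmall := H.delta_small k
  obtain ⟨h1, hX0, hX⟩ := H.qa_mid hk1 hk2 hn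
  rw [abs_le] at h1
  have hqa1 : rstQ m / 2 ≤ (rstLaw m d k).qa n := by nlinarith [mul_nonneg hq.le hΔ0]
  have hqa2 : (rstLaw m d k).qa n ≤ 2 * rstQ m := by nlinarith [mul_nonneg hq.le hΔ0]
  exact psl_conditions hq (by linarith [H.q_le]) H.lam_pos H.lam_le hqa1 hqa2 hX0 hX

/-- **`LawBounds` at the top stage** (`R_init`): the only acceptable size is `m`, where `q_a = q`. [cite: RossmanServedioTan2015, §7.2 Def. 6 (p. 16) and §10.1 Lemma 10 (p. 32)] -/
theorem lawBounds_top : (rstLaw m d (d - 1)).LawBounds (rstQ m) (rstQ m) := by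
  have hq := rstQ_pos m
  have hd := H.two_le
  have hlamp : rstLam m < rstP m := by
    have := H.lam_le; rw [rstQ_sq] at this; linarith [rstP_pos m]
  have hqa : ((rstProc m d).law (d - 1)).qa m = rstQ m := qa_top hd hlamp
  refine ⟨by rw [t_top hd]; norm_num, by rw [t_top hd]; norm_num, rstLam_nonneg m, hq.le, le_rfl,
    fun n hn _ => ?_, ?_⟩
  · have : rstAcc m d (d - 1) n = true := hn
    unfold rstAcc at this
    rw [if_neg (by omega), if_pos (by omega)] at this
    have hnm : n = m := of_decide_eq_true this
    rw [hnm]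
    exact ⟨le_of_eq hqa.symm, le_of_eq hqa⟩
  · show rstQ m ≤ 1 - rstLam m
    nlinarith [H.lam_le, H.q_le]

/-- **The switching-lemma side conditions at the top stage** with `Γ = λ/(16 q³)`. [cite: RossmanServedioTan2015, §10.1 Prop. 12 (p. 34) and Lemma 7.5 (p. 20)] -/
theorem pslHyp_top :
    ∀ n, (rstLaw m d (d - 1)).acc n = true → 1 ≤ n →
      0 < (rstLaw m d (d - 1)).qa n ∧ (rstLaw m d (d - 1)).qa n ≤ 1 - (rstLaw m d (d - 1)).lam ∧
        rstLam m / (16 * rstQ m ^ 3) * (rstLaw m d (d - 1)).qa n ≤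
          1 - (rstLaw m d (d - 1)).lam - (rstLaw m d (d - 1)).qa n ∧
        rstLam m / (16 * rstQ m ^ 3) * (rstLaw m d (d - 1)).qa n * (1 - (rstLaw m d (d - 1)).t) ^ n ≤
          (rstLaw m d (d - 1)).lam * (1 - (1 - (rstLaw m d (d - 1)).t) ^ n) := by
  intro n hn _
  have hq := rstQ_pos m
  have hd := H.two_le
  have hlamp : rstLam m < rstP m := by
    have := H.lam_le; rw [rstQ_sq] at this; linarith [rstP_pos m]
  have : rstAcc m d (d - 1) n = true := hn
  unfold rstAcc at this
  rw [if_neg (by omega), if_pos (by omega)] at this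
  have hnm : n = m := of_decide_eq_true this
  rw [hnm]
  have hqa : (rstLaw m d (d - 1)).qa m = rstQ m := qa_top hd hlamp
  have hX : (1 - (rstLaw m d (d - 1)).t) ^ m = rstP m := by
    rw [t_top hd, show (1 : ℝ) - 1 / 2 = 2⁻¹ by norm_num, inv_pow, ← Real.rpow_natCast,
      ← Real.rpow_neg two_pos.le]; rfl
  rw [hqa, hX]
  refine psl_conditions hq (by linarith [H.q_le]) H.lam_pos H.lam_le (by linarith) (by linarith) (rstP_pos m).le ?_
  rw [← rstQ_sq]; nlinarith [sq_nonneg (rstQ m)]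

omit H in
/-- Nothing is acceptable at the unused indices `j ≥ d`. [folklore] -/
theorem acc_of_le {j : ℕ} (hj : d ≤ j) (n : ℕ) : (rstLaw m d j).acc n = false := by
  show rstAcc m d j n = false
  unfold rstAcc; rw [if_pos hj]

/-- **All stage weights are nonnegative** (`0 ≤ R(τ)(ρ)` at every index). [cite: RossmanServedioTan2015, §7.2 Def. 9 (p. 18)] -/
theorem R_nonneg_all (hT : ∀ k, 1 ≤ k → k ≤ d - 1 → 0 < rstT m d k ∧ rstT m d k < 1) (j : ℕ) {A : Type*} [Fintype A]
    {w : ℕ} (τ ρ : BRestr A (Fin w)) : 0 ≤ (rstLaw m d (j + 1)).R τ ρ := by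
  classical
  have hq := rstQ_pos m
  have hd := H.two_le
  have hlamp : rstLam m < rstP m := by
    have := H.lam_le; rw [rstQ_sq] at this; linarith [rstP_pos m]
  have hpq : rstP m < rstQ m := by
    rw [← rstQ_sq, sq]; exact mul_lt_of_lt_one_left hq (by linarith [H.q_le])
  have hC := rstProc_consistent hd hT hlamp hpq
  refine Finset.prod_nonneg fun a _ => (rstLaw m d (j + 1)).ζ_nonneg (hC.t_pos (j + 1)) (hC.t_le_one (j + 1))
    (rstLam_nonneg m) (fun n hn h1 => ?_) _ _
  -- acceptable sizes only occur at the genuine stages, where the switching-lemma conditions hold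
  by_cases hj : d ≤ j + 1
  · rw [acc_of_le hj] at hn; exact absurd hn (by simp)
  by_cases htop : j + 1 = d - 1
  · have h := H.pslHyp_top n (by rw [← htop]; exact hn) h1
    rw [htop]; exact ⟨h.1.le, h.2.1⟩
  · have h := H.pslHyp_mid (k := j + 1) (by omega) (by omega) n hn h1
    exact ⟨h.1.le, h.2.1⟩

end RegimeFacts

end RSTProj

end Literature.Computability.Complexity

end
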